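import Literature.Barriers.AtomisticToContinuum.NoBVEstimatesMultiDDerivativeSmallness
import Literature.Analysis.Calculus.JointSmoothnessPartials
import Mathlib.Analysis.Calculus.UniformLimitsDeriv
import HarnessLib

/-!
# The limit `δ → 0` of the regularised solutions: existence and first properties

Brick B-ε, §3a, of the Kato existence programme for the symmetrizable branch of Rauch's Local
Existence Theorem (towards `Rauch1986_smallAmplitudeExpansionL2`). Under the smallness condition
`eConst e^{eRate T} ℰ_m(u₀) < 1` the family `W_δ(t)(x)` (`NoBVEstimatesMultiDFlowFamily.lean`),
its word derivatives of order `≤ 2`, and the fields `ρ_δ⋆ρ_δ⋆G(W_δ(t))`, `∂ᵢ(ρ_δ⋆ρ_δ⋆G(W_δ(t)))`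
(i.e. `-∂ₜW_δ`, `-∂ᵢ∂ₜW_δ`) are uniformly Cauchy on `[-T, T] × ℝᵈ` as `δ → 0⁺`
(`NoBVEstimatesMultiDFamilySmallness.lean`, `NoBVEstimatesMultiDDerivativeSmallness.lean`). This
file passes to the limit along the filter `𝓝[>] 0`:

* `tendstoUniformlyOn_limUnder` — a uniformly Cauchy family (along any filter) with values in a
  complete space converges uniformly to its pointwise `limUnder`;
* `dtFam`, `Vlim`, `Zlim` — the total-in-`δ` field `ρ_δ⋆ρ_δ⋆G(W_δ(t))` and the limits
  `V_c = lim ∂_cW_δ` (`|c| ≤ 2`), `Z_c = lim ∂_c(ρ_δ⋆ρ_δ⋆G(W_δ))` (`|c| ≤ 1`);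
* `tendstoUniformlyOn_cwd_Wfam`, `tendstoUniformlyOn_dtFam`, `tendstoUniformlyOn_cwd_dtFam` —
  **uniform convergence on `[-T, T] × ℝᵈ`**;
* `norm_Vlim_le`, `norm_Zlim_le` — the sup bounds `O(R(u₀, T))` pass to the limit;
* `norm_Vlim_sub_le`, `continuousOn_Vlim` — the time-Lipschitz bound passes to the limit, whence
  **joint continuity** of every `V_c` on `[-T, T] × ℝᵈ`;
* `Vlim_nil_zero` — **the initial value** `V_[](0, x) = u₀(x)`.

Everything is proved; no named fact and no `sorry` is introduced.

## References

* [TaylorPDEIII2011] M. E. Taylor, *Partial Differential Equations III*, 2nd ed. (2011), Ch. 16,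
  §1, Thm 1.2 and (1.20)–(1.24).
* [Majda1984] A. Majda, *Compressible Fluid Flow and Systems of Conservation Laws in Several
  Space Variables* (1984), Ch. 2, §2.1, Thm 2.1 (proof, Step 3).
-/

noncomputable section

open MeasureTheory Set Function Filter Metric ContinuousLinearMap
open scoped ContDiff Topology ENNReal NNReal Convolution RealInnerProductSpace

namespace Literature.Barriers.AtomisticToContinuum

open Literature.Analysis.PDE Literature.Analysis.FunctionSpaces Literature.Analysis.ODE
  Literature.Analysis.Calculus

variable {d k : ℕ}

/-! ### Generic: uniform limits along a filter -/

/-- **A uniformly Cauchy family with values in a complete space converges uniformly to its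
pointwise limit** (along an arbitrary non-trivial filter). [folklore] -/
theorem tendstoUniformlyOn_limUnder {ι X Y : Type*} [PseudoMetricSpace Y] [CompleteSpace Y]
    [Nonempty Y] {p : Filter ι} [p.NeBot] {F : ι → X → Y} {S : Set X}
    (h : ∀ ε > (0 : ℝ), ∀ᶠ m in p ×ˢ p, ∀ x ∈ S, dist (F m.1 x) (F m.2 x) < ε) :
    TendstoUniformlyOn F (fun x => limUnder p fun n => F n x) p S := by
  have hC : UniformCauchySeqOn F p S := fun u hu => by
    obtain ⟨ε, hε, hεu⟩ := Metric.mem_uniformity_dist.1 hu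
    exact (h ε hε).mono fun m hm x hx => hεu (hm x hx)
  refine hC.tendstoUniformlyOn_of_tendsto fun x hx => tendsto_nhds_limUnder ?_
  exact cauchy_map_iff_exists_tendsto.1 (hC.cauchy_map hx)

/-- Limits of `f δ (g δ)` for continuous linear maps `f δ → A` and vectors `g δ → v`. [folklore] -/
theorem tendsto_clm_apply {ι E F : Type*} [NormedAddCommGroup E] [NormedSpace ℝ E]
    [NormedAddCommGroup F] [NormedSpace ℝ F] {l : Filter ι} {f : ι → E →L[ℝ] F} {g : ι → E}
    {A : E →L[ℝ] F} {v : E} (hf : Tendsto f l (𝓝 A)) (hg : Tendsto g l (𝓝 v)) :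
    Tendsto (fun n => f n (g n)) l (𝓝 (A v)) :=
  ((isBoundedBilinearMap_apply (𝕜 := ℝ) (E := E) (F := F)).continuous.tendsto (A, v)).comp
    (hf.prodMk_nhds hg)

/-- `δ ∈ (0, τ]` eventually along `𝓝[>] 0`. [folklore] -/
theorem eventually_pos_le {τ : ℝ} (hτ : 0 < τ) : ∀ᶠ δ in 𝓝[>] (0 : ℝ), 0 < δ ∧ δ ≤ τ := by
  filter_upwards [Ioo_mem_nhdsGT hτ] with δ hδ using ⟨hδ.1, hδ.2.le⟩

/-- `δ → 0` along `𝓝[>] 0`. [folklore] -/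
theorem tendsto_self_nhdsGT : Tendsto (fun δ : ℝ => δ) (𝓝[>] (0 : ℝ)) (𝓝 0) :=
  tendsto_id.mono_left nhdsWithin_le_nhds

/-! ### The total field `ρ_δ ⋆ ρ_δ ⋆ G(W_δ(t))` and the limit fields -/

variable {M L : ℝ} {a : Fin d → EuclideanSpace ℝ (Fin k) → (EuclideanSpace ℝ (Fin k) →L[ℝ] EuclideanSpace ℝ (Fin k))}
  {b : EuclideanSpace ℝ (Fin k) → EuclideanSpace ℝ (Fin k)}
  {s : EuclideanSpace ℝ (Fin k) → (EuclideanSpace ℝ (Fin k) →L[ℝ] EuclideanSpace ℝ (Fin k))}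
  {u₀ : EuclideanSpace ℝ (Fin d) → EuclideanSpace ℝ (Fin k)}

/-- **`(ρ_δ ⋆ ρ_δ ⋆ G(W_δ(t)))(x)`** as a total function of `δ` (value `0` for `δ ≤ 0`); this is
`-∂ₜW_δ(t)(x)` (`hasDerivAt_Wfam`). [cite: TaylorPDEIII2011, Ch. 16 §1, (1.9)] -/
def dtFam (h : IsTameCoeff M L a b) (hu₀ : ContDiff ℝ ∞ u₀) (hu₀c : HasCompactSupport u₀)
    (δ t : ℝ) (x : EuclideanSpace ℝ (Fin d)) : EuclideanSpace ℝ (Fin k) :=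
  if hδ : 0 < δ then (moll (Fin d) hδ ⋆[lsmul ℝ ℝ, volume] (moll (Fin d) hδ ⋆[lsmul ℝ ℝ, volume]
    gfield a b (Wfam h hu₀ hu₀c δ t))) x else 0

/-- Unfolding for `δ > 0`. [folklore] -/
theorem dtFam_eq (h : IsTameCoeff M L a b) (hu₀ : ContDiff ℝ ∞ u₀) (hu₀c : HasCompactSupport u₀)
    {δ : ℝ} (hδ : 0 < δ) (t : ℝ) :
    dtFam h hu₀ hu₀c δ t = moll (Fin d) hδ ⋆[lsmul ℝ ℝ, volume] (moll (Fin d) hδ ⋆[lsmul ℝ ℝ, volume]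
      gfield a b (Wfam h hu₀ hu₀c δ t)) := by
  funext x
  simp [dtFam, hδ]

/-- **The limit fields `V_c(t, x) = lim_{δ→0⁺} ∂_cW_δ(t)(x)`** (pointwise `limUnder`; for
`|c| ≤ 2` and `|t| ≤ T` these are uniform limits, `tendstoUniformlyOn_cwd_Wfam`); `V_[]` is the
solution `w`. [cite: TaylorPDEIII2011, Ch. 16 §1, (1.20)–(1.23)] -/
def Vlim (h : IsTameCoeff M L a b) (hu₀ : ContDiff ℝ ∞ u₀) (hu₀c : HasCompactSupport u₀)
    (c : List (Fin d)) (p : ℝ × EuclideanSpace ℝ (Fin d)) : EuclideanSpace ℝ (Fin k) :=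
  limUnder (𝓝[>] (0 : ℝ)) fun δ => cwd c (Wfam h hu₀ hu₀c δ p.1) p.2

/-- **The limit fields `Z_c(t, x) = lim_{δ→0⁺} ∂_c(ρ_δ⋆ρ_δ⋆G(W_δ(t)))(x)`** (uniform limits for
`|c| ≤ 1`, `|t| ≤ T`); `-Z_[]` is `∂ₜw` and `-Z_[i]` is `∂ₜ∂ᵢw`.
[cite: TaylorPDEIII2011, Ch. 16 §1, (1.22)–(1.24)] -/
def Zlim (h : IsTameCoeff M L a b) (hu₀ : ContDiff ℝ ∞ u₀) (hu₀c : HasCompactSupport u₀)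
    (c : List (Fin d)) (p : ℝ × EuclideanSpace ℝ (Fin d)) : EuclideanSpace ℝ (Fin k) :=
  limUnder (𝓝[>] (0 : ℝ)) fun δ => cwd c (dtFam h hu₀ hu₀c δ p.1) p.2

/-! ### Pointwise bounds of `G(w)` and `∂ᵢG(w)` through the jet -/

/-- `‖G(w)(x)‖ ≤ dMR + L‖w(x)‖` when `‖∂ⱼw(x)‖ ≤ R`. [cite: Majda1984, Ch. 2 §2.1] -/
theorem norm_gfield_apply_le (hS : IsSymmSmoothCoeff M L a b s)
    {w : EuclideanSpace ℝ (Fin d) → EuclideanSpace ℝ (Fin k)} {R : ℝ} (x : EuclideanSpace ℝ (Fin d))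
    (h1 : ∀ j, ‖cwd [j] w x‖ ≤ R) :
    ‖gfield a b w x‖ ≤ d * M * R + L * ‖w x‖ := by
  have hM0 : 0 ≤ M := hS.M_nonneg
  unfold gfield
  refine (norm_add_le _ _).trans (add_le_add ?_ (hS.norm_b_le _))
  calc ‖∑ j, a j (w x) (cwd [j] w x)‖ ≤ ∑ j, ‖a j (w x) (cwd [j] w x)‖ := norm_sum_le _ _
    _ ≤ ∑ _j : Fin d, M * R := Finset.sum_le_sum fun j _ =>
        (le_opNorm _ _).trans (mul_le_mul (hS.norm_a j _) (h1 j) (norm_nonneg _) hM0)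
    _ = d * M * R := by simp; ring

/-- `‖∂ᵢG(w)(x)‖ ≤ d(MR + MR²) + LR` when the word derivatives of orders `1` and `(i, ·)` of the
smooth field `w` are bounded by `R` at `x`. [cite: Majda1984, Ch. 2 §2.1] -/
theorem norm_cwd_singleton_gfield_le (hS : IsSymmSmoothCoeff M L a b s)
    {w : EuclideanSpace ℝ (Fin d) → EuclideanSpace ℝ (Fin k)} (hw : ContDiff ℝ ∞ w) {R : ℝ}
    (hR : 0 ≤ R) (i : Fin d) (x : EuclideanSpace ℝ (Fin d)) (h1 : ∀ j, ‖cwd [j] w x‖ ≤ R)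
    (h2 : ∀ j, ‖cwd [i, j] w x‖ ≤ R) :
    ‖cwd [i] (gfield a b w) x‖ ≤ d * (M * R + M * R ^ 2) + L * R := by
  have hM0 : 0 ≤ M := hS.M_nonneg
  have hL0 : 0 ≤ L := hS.L_nonneg
  rw [cwd_singleton_gfield_eq hS hw i x]
  refine (norm_add_le _ _).trans (add_le_add ?_ ?_)
  · calc ‖∑ j, (a j (w x) (cwd [i, j] w x) + fderiv ℝ (a j) (w x) (cwd [i] w x) (cwd [j] w x))‖
          ≤ ∑ j, ‖a j (w x) (cwd [i, j] w x) + fderiv ℝ (a j) (w x) (cwd [i] w x) (cwd [j] w x)‖ :=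
          norm_sum_le _ _
      _ ≤ ∑ _j : Fin d, (M * R + M * R ^ 2) := by
          refine Finset.sum_le_sum fun j _ => (norm_add_le _ _).trans (add_le_add ?_ ?_)
          · exact (le_opNorm _ _).trans (mul_le_mul (hS.norm_a j _) (h2 j) (norm_nonneg _) hM0)
          · calc ‖fderiv ℝ (a j) (w x) (cwd [i] w x) (cwd [j] w x)‖
                ≤ ‖fderiv ℝ (a j) (w x)‖ * ‖cwd [i] w x‖ * ‖cwd [j] w x‖ := le_opNorm₂ _ _ _
              _ ≤ M * R * R := mul_le_mul (mul_le_mul (hS.norm_fderiv_a j _) (h1 i) (norm_nonneg _) hM0)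
                  (h1 j) (norm_nonneg _) (mul_nonneg hM0 hR)
              _ = M * R ^ 2 := by ring
      _ = d * (M * R + M * R ^ 2) := by
          rw [Finset.sum_const, Finset.card_univ, Fintype.card_fin, nsmul_eq_mul]
  · exact (le_opNorm _ _).trans (mul_le_mul (hS.norm_fderiv_b _) (h1 i) (norm_nonneg _) hL0)

section Family

variable (hS : IsSymmSmoothCoeff M L a b s) {m : ℕ} (hm : 4 * (d + 1) ≤ m)
  (hu₀ : ContDiff ℝ ∞ u₀) (hu₀c : HasCompactSupport u₀) {T : ℝ} (hT : 0 ≤ T)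
  (hsm : eConst hS hm * Real.exp (eRate hS hm * T) * wordEnergy m u₀ < 1)

/-! ### Eventual (in `δ, δ'`) smallness along `𝓝[>] 0` -/

include hT hsm in
/-- The sup-Cauchy smallness of `∂_cW_δ` (`|c| ≤ 2`), eventually along `𝓝[>] 0 ×ˢ 𝓝[>] 0`.
[cite: Majda1984, Ch. 2 §2.1, Thm 2.1 (proof, Step 3)] -/
theorem eventually_small_cwd_Wfam (hm1 : 4 * (d + 1) + 1 ≤ m) {ε : ℝ} (hε : 0 < ε) :
    ∀ᶠ mm in (𝓝[>] (0 : ℝ)) ×ˢ (𝓝[>] (0 : ℝ)), ∀ t ∈ Icc (-T) T, ∀ c : List (Fin d),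
      c.length ≤ 2 → ∀ x,
        ‖cwd c (Wfam hS.toIsTameCoeff hu₀ hu₀c mm.1 t) x - cwd c (Wfam hS.toIsTameCoeff hu₀ hu₀c mm.2 t) x‖ ≤ ε := by
  obtain ⟨η, hη0, hη⟩ := exists_sup_small_Wfam hS hm hm1 hε
  obtain ⟨Cq, hCq⟩ : ∃ x : ℝ, x = cConst hS hm * Real.exp (cRate hS hm * T) * (1 + ∑ j, l2norm (cwd [j] u₀)) :=
    ⟨_, rfl⟩
  have hCq0 : 0 ≤ Cq := by
    rw [hCq]
    exact mul_nonneg (mul_nonneg (cConst_nonneg hS hm) (Real.exp_nonneg _))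
      (add_nonneg zero_le_one (Finset.sum_nonneg fun j _ => l2norm_nonneg _))
  obtain ⟨τ, hτ⟩ : ∃ x : ℝ, x = η / (2 * (Cq + 1)) := ⟨_, rfl⟩
  have hτ0 : 0 < τ := by rw [hτ]; positivity
  have hev := eventually_pos_le (lt_min zero_lt_one hτ0)
  filter_upwards [hev.prod_mk hev] with mm hmm t ht c hc x
  obtain ⟨⟨h1, h1'⟩, ⟨h2, h2'⟩⟩ := hmm
  refine hη hu₀ hu₀c hT hsm h1 (h1'.trans (min_le_left _ _)) h2 (h2'.trans (min_le_left _ _)) t ht ?_ c hc x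
  have hs1 : mm.1 ≤ τ := h1'.trans (min_le_right _ _)
  have hs2 : mm.2 ≤ τ := h2'.trans (min_le_right _ _)
  calc cConst hS hm * Real.exp (cRate hS hm * T) * (mm.1 + mm.2) * (1 + ∑ j, l2norm (cwd [j] u₀))
      = Cq * (mm.1 + mm.2) := by rw [hCq]; ring
    _ ≤ Cq * (τ + τ) := mul_le_mul_of_nonneg_left (add_le_add hs1 hs2) hCq0
    _ = η * (Cq / (Cq + 1)) := by rw [hτ]; field_simp; ring
    _ ≤ η * 1 := mul_le_mul_of_nonneg_left ((div_le_one (by positivity)).2 (by linarith)) hη0.le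
    _ = η := mul_one η

include hT hsm in
/-- The sup-Cauchy smallness of `ρ_δ⋆ρ_δ⋆G(W_δ)`, eventually along `𝓝[>] 0 ×ˢ 𝓝[>] 0`.
[cite: TaylorPDEIII2011, Ch. 16 §1, (1.21)–(1.22)] -/
theorem eventually_small_dtFam (hm1 : 4 * (d + 1) + 1 ≤ m) {ε : ℝ} (hε : 0 < ε) :
    ∀ᶠ mm in (𝓝[>] (0 : ℝ)) ×ˢ (𝓝[>] (0 : ℝ)), ∀ t ∈ Icc (-T) T, ∀ x,
      ‖dtFam hS.toIsTameCoeff hu₀ hu₀c mm.1 t x - dtFam hS.toIsTameCoeff hu₀ hu₀c mm.2 t x‖ ≤ ε := by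
  obtain ⟨η, θ, hη0, hθ0, hη⟩ := exists_sup_small_dtWfam hS hm hm1 hε
  obtain ⟨Cq, hCq⟩ : ∃ x : ℝ, x = cConst hS hm * Real.exp (cRate hS hm * T) * (1 + ∑ j, l2norm (cwd [j] u₀)) :=
    ⟨_, rfl⟩
  have hCq0 : 0 ≤ Cq := by
    rw [hCq]
    exact mul_nonneg (mul_nonneg (cConst_nonneg hS hm) (Real.exp_nonneg _))
      (add_nonneg zero_le_one (Finset.sum_nonneg fun j _ => l2norm_nonneg _))
  obtain ⟨τ, hτ⟩ : ∃ x : ℝ, x = η / (2 * (Cq + 1)) := ⟨_, rfl⟩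
  have hτ0 : 0 < τ := by rw [hτ]; positivity
  have hev := eventually_pos_le (lt_min zero_lt_one (lt_min hτ0 (half_pos hθ0)))
  filter_upwards [hev.prod_mk hev] with mm hmm t ht x
  obtain ⟨⟨h1, h1'⟩, ⟨h2, h2'⟩⟩ := hmm
  have hs1 : mm.1 ≤ τ := (h1'.trans (min_le_right _ _)).trans (min_le_left _ _)
  have hs2 : mm.2 ≤ τ := (h2'.trans (min_le_right _ _)).trans (min_le_left _ _)
  have hq1 : mm.1 ≤ θ / 2 := (h1'.trans (min_le_right _ _)).trans (min_le_right _ _)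
  have hq2 : mm.2 ≤ θ / 2 := (h2'.trans (min_le_right _ _)).trans (min_le_right _ _)
  have h := hη hu₀ hu₀c hT hsm h1 (h1'.trans (min_le_left _ _)) h2 (h2'.trans (min_le_left _ _))
    (by linarith) t ht ?_ x
  · rw [dtFam_eq _ hu₀ hu₀c h1, dtFam_eq _ hu₀ hu₀c h2]
    exact h
  calc cConst hS hm * Real.exp (cRate hS hm * T) * (mm.1 + mm.2) * (1 + ∑ j, l2norm (cwd [j] u₀))
      = Cq * (mm.1 + mm.2) := by rw [hCq]; ring
    _ ≤ Cq * (τ + τ) := mul_le_mul_of_nonneg_left (add_le_add hs1 hs2) hCq0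
    _ = η * (Cq / (Cq + 1)) := by rw [hτ]; field_simp; ring
    _ ≤ η * 1 := mul_le_mul_of_nonneg_left ((div_le_one (by positivity)).2 (by linarith)) hη0.le
    _ = η := mul_one η

include hT hsm in
/-- The sup-Cauchy smallness of `∂ᵢ(ρ_δ⋆ρ_δ⋆G(W_δ))`, eventually along `𝓝[>] 0 ×ˢ 𝓝[>] 0`.
[cite: TaylorPDEIII2011, Ch. 16 §1, (1.21)–(1.22)] -/
theorem eventually_small_cwd_dtFam (hm1 : 4 * (d + 1) + 1 ≤ m) {ε : ℝ} (hε : 0 < ε) :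
    ∀ᶠ mm in (𝓝[>] (0 : ℝ)) ×ˢ (𝓝[>] (0 : ℝ)), ∀ t ∈ Icc (-T) T, ∀ (i : Fin d) x,
      ‖cwd [i] (dtFam hS.toIsTameCoeff hu₀ hu₀c mm.1 t) x - cwd [i] (dtFam hS.toIsTameCoeff hu₀ hu₀c mm.2 t) x‖ ≤ ε := by
  obtain ⟨η, θ, hη0, hθ0, hη⟩ := exists_sup_small_dxdtWfam hS hm hm1 hε
  obtain ⟨Cq, hCq⟩ : ∃ x : ℝ, x = cConst hS hm * Real.exp (cRate hS hm * T) * (1 + ∑ j, l2norm (cwd [j] u₀)) :=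
    ⟨_, rfl⟩
  have hCq0 : 0 ≤ Cq := by
    rw [hCq]
    exact mul_nonneg (mul_nonneg (cConst_nonneg hS hm) (Real.exp_nonneg _))
      (add_nonneg zero_le_one (Finset.sum_nonneg fun j _ => l2norm_nonneg _))
  obtain ⟨τ, hτ⟩ : ∃ x : ℝ, x = η / (2 * (Cq + 1)) := ⟨_, rfl⟩
  have hτ0 : 0 < τ := by rw [hτ]; positivity
  have hev := eventually_pos_le (lt_min zero_lt_one (lt_min hτ0 (half_pos hθ0)))
  filter_upwards [hev.prod_mk hev] with mm hmm t ht i x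
  obtain ⟨⟨h1, h1'⟩, ⟨h2, h2'⟩⟩ := hmm
  have hs1 : mm.1 ≤ τ := (h1'.trans (min_le_right _ _)).trans (min_le_left _ _)
  have hs2 : mm.2 ≤ τ := (h2'.trans (min_le_right _ _)).trans (min_le_left _ _)
  have hq1 : mm.1 ≤ θ / 2 := (h1'.trans (min_le_right _ _)).trans (min_le_right _ _)
  have hq2 : mm.2 ≤ θ / 2 := (h2'.trans (min_le_right _ _)).trans (min_le_right _ _)
  have h := hη hu₀ hu₀c hT hsm h1 (h1'.trans (min_le_left _ _)) h2 (h2'.trans (min_le_left _ _))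
    (by linarith) t ht ?_ i x
  · rw [dtFam_eq _ hu₀ hu₀c h1, dtFam_eq _ hu₀ hu₀c h2]
    exact h
  calc cConst hS hm * Real.exp (cRate hS hm * T) * (mm.1 + mm.2) * (1 + ∑ j, l2norm (cwd [j] u₀))
      = Cq * (mm.1 + mm.2) := by rw [hCq]; ring
    _ ≤ Cq * (τ + τ) := mul_le_mul_of_nonneg_left (add_le_add hs1 hs2) hCq0
    _ = η * (Cq / (Cq + 1)) := by rw [hτ]; field_simp; ring
    _ ≤ η * 1 := mul_le_mul_of_nonneg_left ((div_le_one (by positivity)).2 (by linarith)) hη0.le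
    _ = η := mul_one η

/-! ### Uniform convergence on `[-T, T] × ℝᵈ` -/

include hT hsm in
/-- **`∂_cW_δ → V_c` uniformly on `[-T, T] × ℝᵈ`** as `δ → 0⁺`, for `|c| ≤ 2`.
[cite: TaylorPDEIII2011, Ch. 16 §1, (1.20)–(1.23)] -/
theorem tendstoUniformlyOn_cwd_Wfam (hm1 : 4 * (d + 1) + 1 ≤ m) (c : List (Fin d)) (hc : c.length ≤ 2) :
    TendstoUniformlyOn (fun δ (p : ℝ × EuclideanSpace ℝ (Fin d)) => cwd c (Wfam hS.toIsTameCoeff hu₀ hu₀c δ p.1) p.2)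
      (Vlim hS.toIsTameCoeff hu₀ hu₀c c) (𝓝[>] (0 : ℝ)) (Icc (-T) T ×ˢ univ) := by
  refine tendstoUniformlyOn_limUnder fun ε hε => ?_
  filter_upwards [eventually_small_cwd_Wfam hS hm hu₀ hu₀c hT hsm hm1 (half_pos hε)] with mm hmm p hp
  rw [dist_eq_norm]
  exact (hmm p.1 hp.1 c hc p.2).trans_lt (half_lt_self hε)

include hT hsm in
/-- **`ρ_δ⋆ρ_δ⋆G(W_δ) → Z_[]` uniformly on `[-T, T] × ℝᵈ`** as `δ → 0⁺`.
[cite: TaylorPDEIII2011, Ch. 16 §1, (1.22)] -/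
theorem tendstoUniformlyOn_dtFam (hm1 : 4 * (d + 1) + 1 ≤ m) :
    TendstoUniformlyOn (fun δ (p : ℝ × EuclideanSpace ℝ (Fin d)) => dtFam hS.toIsTameCoeff hu₀ hu₀c δ p.1 p.2)
      (Zlim hS.toIsTameCoeff hu₀ hu₀c []) (𝓝[>] (0 : ℝ)) (Icc (-T) T ×ˢ univ) := by
  refine tendstoUniformlyOn_limUnder fun ε hε => ?_
  filter_upwards [eventually_small_dtFam hS hm hu₀ hu₀c hT hsm hm1 (half_pos hε)] with mm hmm p hp
  rw [dist_eq_norm]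
  exact (hmm p.1 hp.1 p.2).trans_lt (half_lt_self hε)

include hT hsm in
/-- **`∂ᵢ(ρ_δ⋆ρ_δ⋆G(W_δ)) → Z_[i]` uniformly on `[-T, T] × ℝᵈ`** as `δ → 0⁺`.
[cite: TaylorPDEIII2011, Ch. 16 §1, (1.22)] -/
theorem tendstoUniformlyOn_cwd_dtFam (hm1 : 4 * (d + 1) + 1 ≤ m) (i : Fin d) :
    TendstoUniformlyOn (fun δ (p : ℝ × EuclideanSpace ℝ (Fin d)) => cwd [i] (dtFam hS.toIsTameCoeff hu₀ hu₀c δ p.1) p.2)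
      (Zlim hS.toIsTameCoeff hu₀ hu₀c [i]) (𝓝[>] (0 : ℝ)) (Icc (-T) T ×ˢ univ) := by
  refine tendstoUniformlyOn_limUnder fun ε hε => ?_
  filter_upwards [eventually_small_cwd_dtFam hS hm hu₀ hu₀c hT hsm hm1 (half_pos hε)] with mm hmm p hp
  rw [dist_eq_norm]
  exact (hmm p.1 hp.1 i p.2).trans_lt (half_lt_self hε)

include hT hsm in
/-- Pointwise form: `∂_cW_δ(t)(x) → V_c(t, x)`. [folklore] -/
theorem tendsto_cwd_Wfam (hm1 : 4 * (d + 1) + 1 ≤ m) (c : List (Fin d)) (hc : c.length ≤ 2) {t : ℝ}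
    (ht : t ∈ Icc (-T) T) (x : EuclideanSpace ℝ (Fin d)) :
    Tendsto (fun δ => cwd c (Wfam hS.toIsTameCoeff hu₀ hu₀c δ t) x) (𝓝[>] (0 : ℝ))
      (𝓝 (Vlim hS.toIsTameCoeff hu₀ hu₀c c (t, x))) := by
  have hmem : ((t, x) : ℝ × EuclideanSpace ℝ (Fin d)) ∈ Icc (-T) T ×ˢ (univ : Set (EuclideanSpace ℝ (Fin d))) :=
    mk_mem_prod ht (mem_univ x)
  have h := (tendstoUniformlyOn_cwd_Wfam hS hm hu₀ hu₀c hT hsm hm1 c hc).tendsto_at hmem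
  exact h

include hT hsm in
/-- Pointwise form: `(ρ_δ⋆ρ_δ⋆G(W_δ(t)))(x) → Z_[](t, x)`. [folklore] -/
theorem tendsto_dtFam (hm1 : 4 * (d + 1) + 1 ≤ m) {t : ℝ} (ht : t ∈ Icc (-T) T) (x : EuclideanSpace ℝ (Fin d)) :
    Tendsto (fun δ => dtFam hS.toIsTameCoeff hu₀ hu₀c δ t x) (𝓝[>] (0 : ℝ))
      (𝓝 (Zlim hS.toIsTameCoeff hu₀ hu₀c [] (t, x))) := by
  have hmem : ((t, x) : ℝ × EuclideanSpace ℝ (Fin d)) ∈ Icc (-T) T ×ˢ (univ : Set (EuclideanSpace ℝ (Fin d))) :=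
    mk_mem_prod ht (mem_univ x)
  have h := (tendstoUniformlyOn_dtFam hS hm hu₀ hu₀c hT hsm hm1).tendsto_at hmem
  exact h

include hT hsm in
/-- Pointwise form: `∂ᵢ(ρ_δ⋆ρ_δ⋆G(W_δ(t)))(x) → Z_[i](t, x)`. [folklore] -/
theorem tendsto_cwd_dtFam (hm1 : 4 * (d + 1) + 1 ≤ m) (i : Fin d) {t : ℝ} (ht : t ∈ Icc (-T) T)
    (x : EuclideanSpace ℝ (Fin d)) :
    Tendsto (fun δ => cwd [i] (dtFam hS.toIsTameCoeff hu₀ hu₀c δ t) x) (𝓝[>] (0 : ℝ))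
      (𝓝 (Zlim hS.toIsTameCoeff hu₀ hu₀c [i] (t, x))) := by
  have hmem : ((t, x) : ℝ × EuclideanSpace ℝ (Fin d)) ∈ Icc (-T) T ×ˢ (univ : Set (EuclideanSpace ℝ (Fin d))) :=
    mk_mem_prod ht (mem_univ x)
  have h := (tendstoUniformlyOn_cwd_dtFam hS hm hu₀ hu₀c hT hsm hm1 i).tendsto_at hmem
  exact h

/-! ### Bounds pass to the limit -/

include hT hsm in
/-- **`‖V_c(t, x)‖ ≤ R(u₀, T)`** for `|c| ≤ 2`, `|t| ≤ T`. [cite: Majda1984, Ch. 2 §2.1, Thm 2.1] -/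
theorem norm_Vlim_le (hm1 : 4 * (d + 1) + 1 ≤ m) {t : ℝ} (ht : t ∈ Icc (-T) T) (c : List (Fin d))
    (hc : c.length ≤ 2) (x : EuclideanSpace ℝ (Fin d)) :
    ‖Vlim hS.toIsTameCoeff hu₀ hu₀c c (t, x)‖ ≤ Rdat hS hm T u₀ := by
  refine le_of_tendsto (tendsto_cwd_Wfam hS hm hu₀ hu₀c hT hsm hm1 c hc ht x).norm ?_
  filter_upwards [eventually_pos_le zero_lt_one] with δ hδ
  exact norm_cwd_Wfam_le_Rdat hS hm hu₀ hu₀c hT hsm hδ.1 hδ.2 ht c (by omega) x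

include hT hsm in
/-- Sup bound of the approximants of `Z_c`: `‖∂_c(ρ_δ⋆ρ_δ⋆G(W_δ(t)))(x)‖ ≤ (dM(1 + C^{1/2}) + L) R(u₀, T)`
for `|c| ≤ 1`, `δ ∈ (0, 1]`, `|t| ≤ T`. [cite: Majda1984, Ch. 2 §2.1] -/
theorem norm_cwd_dtFam_le (hm1 : 4 * (d + 1) + 1 ≤ m) {δ : ℝ} (hδ : 0 < δ) (hδ1 : δ ≤ 1) {t : ℝ}
    (ht : t ∈ Icc (-T) T) (c : List (Fin d)) (hc : c.length ≤ 1) (x : EuclideanSpace ℝ (Fin d)) :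
    ‖cwd c (dtFam hS.toIsTameCoeff hu₀ hu₀c δ t) x‖ ≤
      (d * M * (1 + Real.sqrt (supConst (Fin d) (EuclideanSpace ℝ (Fin k)))) + L) * Rdat hS hm T u₀ := by
  have hM0 : 0 ≤ M := hS.M_nonneg
  have hL0 : 0 ≤ L := hS.L_nonneg
  have hd0 : (0 : ℝ) ≤ d := Nat.cast_nonneg d
  set R := Rdat hS hm T u₀ with hR
  have hR0 : 0 ≤ R := Rdat_nonneg hS hm T u₀
  set R₀ := Real.sqrt (supConst (Fin d) (EuclideanSpace ℝ (Fin k))) with hR₀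
  have hR₀0 : 0 ≤ R₀ := Real.sqrt_nonneg _
  have hRR₀ : R ≤ R₀ := Rdat_le_sqrt_supConst hS hm hsm
  have hWs := contDiff_Wfam hS.toIsTameCoeff hu₀ hu₀c hδ t
  have hsup : ∀ c' : List (Fin d), c'.length ≤ 2 → ∀ y, ‖cwd c' (Wfam hS.toIsTameCoeff hu₀ hu₀c δ t) y‖ ≤ R :=
    fun c' hc' y => norm_cwd_Wfam_le_Rdat hS hm hu₀ hu₀c hT hsm hδ hδ1 ht c' (by omega) y
  rw [dtFam_eq _ hu₀ hu₀c hδ]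
  refine norm_cwd_moll_moll_le hδ (contDiff_gfield hS hWs) c (fun y => ?_) x
  -- `‖∂_c G(W_δ(t))(y)‖ ≤ (dM(1+R₀) + L) R`
  match c, hc with
  | [], _ =>
    rw [cwd_nil]
    have h0 : ‖Wfam hS.toIsTameCoeff hu₀ hu₀c δ t y‖ ≤ R := by simpa using hsup [] (by simp) y
    calc ‖gfield a b (Wfam hS.toIsTameCoeff hu₀ hu₀c δ t) y‖
        ≤ d * M * R + L * ‖Wfam hS.toIsTameCoeff hu₀ hu₀c δ t y‖ :=
          norm_gfield_apply_le hS y fun j => hsup [j] (by simp) y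
      _ ≤ d * M * R + L * R := add_le_add le_rfl (mul_le_mul_of_nonneg_left h0 hL0)
      _ ≤ (d * M * (1 + R₀) + L) * R := by nlinarith [mul_nonneg (mul_nonneg hd0 hM0) (mul_nonneg hR₀0 hR0)]
  | [i], _ =>
    calc ‖cwd [i] (gfield a b (Wfam hS.toIsTameCoeff hu₀ hu₀c δ t)) y‖
        ≤ d * (M * R + M * R ^ 2) + L * R :=
          norm_cwd_singleton_gfield_le hS hWs hR0 i y (fun j => hsup [j] (by simp) y)
            (fun j => hsup [i, j] (by simp) y)
      _ ≤ (d * M * (1 + R₀) + L) * R := by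
          have h2 : R ^ 2 ≤ R₀ * R := by rw [sq]; exact mul_le_mul_of_nonneg_right hRR₀ hR0
          nlinarith [mul_le_mul_of_nonneg_left h2 (mul_nonneg hd0 hM0)]
  | _ :: _ :: _, hc => simp at hc

include hT hsm in
/-- **`‖Z_c(t, x)‖ ≤ (dM(1 + C^{1/2}) + L) R(u₀, T)`** for `|c| ≤ 1`, `|t| ≤ T`.
[cite: Majda1984, Ch. 2 §2.1, Thm 2.1] -/
theorem norm_Zlim_le (hm1 : 4 * (d + 1) + 1 ≤ m) {t : ℝ} (ht : t ∈ Icc (-T) T) (c : List (Fin d))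
    (hc : c.length ≤ 1) (x : EuclideanSpace ℝ (Fin d)) :
    ‖Zlim hS.toIsTameCoeff hu₀ hu₀c c (t, x)‖ ≤
      (d * M * (1 + Real.sqrt (supConst (Fin d) (EuclideanSpace ℝ (Fin k)))) + L) * Rdat hS hm T u₀ := by
  have hlim : Tendsto (fun δ => cwd c (dtFam hS.toIsTameCoeff hu₀ hu₀c δ t) x) (𝓝[>] (0 : ℝ))
      (𝓝 (Zlim hS.toIsTameCoeff hu₀ hu₀c c (t, x))) := by
    match c, hc with
    | [], _ => exact tendsto_dtFam hS hm hu₀ hu₀c hT hsm hm1 ht x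
    | [i], _ => exact tendsto_cwd_dtFam hS hm hu₀ hu₀c hT hsm hm1 i ht x
    | _ :: _ :: _, hc => simp at hc
  refine le_of_tendsto hlim.norm ?_
  filter_upwards [eventually_pos_le zero_lt_one] with δ hδ
  exact norm_cwd_dtFam_le hS hm hu₀ hu₀c hT hsm hm1 hδ.1 hδ.2 ht c hc x

/-! ### Time-Lipschitz bound and joint continuity of the limit fields -/

include hT hsm in
/-- **The time-Lipschitz bound passes to the limit**: `‖V_c(t, x) - V_c(t', x)‖ ≤ Λ|t - t'|`
for `|c| ≤ 2`, `t, t' ∈ [-T, T]`. [cite: Majda1984, Ch. 2 §2.1, Thm 2.1 (proof, Step 3)] -/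
theorem norm_Vlim_sub_le (hm1 : 4 * (d + 1) + 1 ≤ m) :
    ∃ Λ : ℝ, 0 ≤ Λ ∧ ∀ t ∈ Icc (-T) T, ∀ t' ∈ Icc (-T) T, ∀ c : List (Fin d), c.length ≤ 2 → ∀ x,
      ‖Vlim hS.toIsTameCoeff hu₀ hu₀c c (t, x) - Vlim hS.toIsTameCoeff hu₀ hu₀c c (t', x)‖ ≤ Λ * |t - t'| := by
  obtain ⟨Λ, hΛ0, hΛ⟩ := exists_time_lipschitz_Wfam hS hm hm1
  refine ⟨Λ, hΛ0, fun t ht t' ht' c hc x => ?_⟩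
  have h1 := tendsto_cwd_Wfam hS hm hu₀ hu₀c hT hsm hm1 c hc ht x
  have h2 := tendsto_cwd_Wfam hS hm hu₀ hu₀c hT hsm hm1 c hc ht' x
  refine le_of_tendsto (h1.sub h2).norm ?_
  filter_upwards [eventually_pos_le zero_lt_one] with δ hδ
  exact hΛ hu₀ hu₀c hT hsm hδ.1 hδ.2 t ht t' ht' c hc x

include hT hsm in
/-- Every slice `x ↦ V_c(t, x)` (`|c| ≤ 2`, `|t| ≤ T`) is continuous (a uniform limit of smooth
slices). [folklore] -/
theorem continuous_Vlim_slice (hm1 : 4 * (d + 1) + 1 ≤ m) (c : List (Fin d)) (hc : c.length ≤ 2)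
    {t : ℝ} (ht : t ∈ Icc (-T) T) :
    Continuous fun x => Vlim hS.toIsTameCoeff hu₀ hu₀c c (t, x) := by
  have hU := (tendstoUniformlyOn_cwd_Wfam hS hm hu₀ hu₀c hT hsm hm1 c hc).comp
    (fun x : EuclideanSpace ℝ (Fin d) => (t, x))
  have hpre : (fun x : EuclideanSpace ℝ (Fin d) => (t, x)) ⁻¹' (Icc (-T) T ×ˢ (univ : Set (EuclideanSpace ℝ (Fin d)))) =
      univ := by
    ext x
    simp [ht.1, ht.2]
  rw [hpre] at hU
  have hcont : ∀ᶠ δ in 𝓝[>] (0 : ℝ), ContinuousOn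
      ((fun (p : ℝ × EuclideanSpace ℝ (Fin d)) => cwd c (Wfam hS.toIsTameCoeff hu₀ hu₀c δ p.1) p.2) ∘
        fun x : EuclideanSpace ℝ (Fin d) => (t, x)) univ := by
    filter_upwards [eventually_pos_le zero_lt_one] with δ hδ
    exact (continuous_cwd (contDiff_Wfam hS.toIsTameCoeff hu₀ hu₀c hδ.1 t) c).continuousOn
  exact continuousOn_univ.1 (hU.continuousOn hcont.frequently)

include hT hsm in
/-- **Joint continuity of the limit fields**: `V_c` is continuous on `[-T, T] × ℝᵈ` for `|c| ≤ 2`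
(continuity of the slices and the uniform-in-`x` time-Lipschitz bound,
`continuousOn_prod_of_locally_uniform`). [folklore] -/
theorem continuousOn_Vlim (hm1 : 4 * (d + 1) + 1 ≤ m) (c : List (Fin d)) (hc : c.length ≤ 2) :
    ContinuousOn (Vlim hS.toIsTameCoeff hu₀ hu₀c c) (Icc (-T) T ×ˢ univ) := by
  obtain ⟨Λ, hΛ0, hΛ⟩ := norm_Vlim_sub_le hS hm hu₀ hu₀c hT hsm hm1
  have key := continuousOn_prod_of_locally_uniform
    (g := fun t x => Vlim hS.toIsTameCoeff hu₀ hu₀c c (t, x)) (I := Icc (-T) T)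
    (fun t ht => continuous_Vlim_slice hS hm hu₀ hu₀c hT hsm hm1 c hc ht) ?_
  · simpa only [Prod.mk.eta] using key
  intro t₀ ht₀ ε hε
  have hr : 0 < ε / (Λ + 1) := by positivity
  filter_upwards [eventually_mem_nhdsWithin, mem_nhdsWithin_of_mem_nhds (Metric.ball_mem_nhds t₀ hr)]
    with t ht hd y
  rw [dist_eq_norm]
  have hd' : |t - t₀| < ε / (Λ + 1) := by simpa [Real.dist_eq] using hd
  calc ‖Vlim hS.toIsTameCoeff hu₀ hu₀c c (t, y) - Vlim hS.toIsTameCoeff hu₀ hu₀c c (t₀, y)‖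
      ≤ Λ * |t - t₀| := hΛ t ht t₀ ht₀ c hc y
    _ ≤ Λ * (ε / (Λ + 1)) := mul_le_mul_of_nonneg_left hd'.le hΛ0
    _ = ε * (Λ / (Λ + 1)) := by ring
    _ ≤ ε * 1 := mul_le_mul_of_nonneg_left ((div_le_one (by positivity)).2 (by linarith)) hε.le
    _ = ε := mul_one ε

/-! ### The initial value -/

include hT hsm in
/-- **`V_[](0, x) = u₀(x)`**: the limit takes the datum (`W_δ(0) = ρ_δ ⋆ u₀ → u₀`).
[cite: TaylorPDEIII2011, Ch. 16 §1, (1.23)] -/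
theorem Vlim_nil_zero (hm1 : 4 * (d + 1) + 1 ≤ m) (x : EuclideanSpace ℝ (Fin d)) :
    Vlim hS.toIsTameCoeff hu₀ hu₀c [] (0, x) = u₀ x := by
  have h0 : (0 : ℝ) ∈ Icc (-T) T := ⟨by linarith, hT⟩
  have h1 := tendsto_cwd_Wfam hS hm hu₀ hu₀c hT hsm hm1 [] (by simp) h0 x
  refine tendsto_nhds_unique h1 ?_
  have hK := fun i : Fin d => exists_bound_cwd_data hu₀ hu₀c [i]
  choose K hK0 hK using hK
  refine tendsto_sub_nhds_zero_iff.1 (squeeze_zero_norm' (a := fun δ => δ * ∑ i, K i) ?_ ?_)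
  · filter_upwards [eventually_pos_le zero_lt_one] with δ hδ
    simpa using norm_Wfam_zero_sub_le hS.toIsTameCoeff hu₀ hu₀c hδ.1 (K := K) (fun i y => hK i y) x
  · simpa using tendsto_self_nhdsGT.mul_const (∑ i, K i)

end Family

end Literature.Barriers.AtomisticToContinuum

end
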